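import Summits.RiemannHypothesis.RiemannHypothesis.Theorems.WeilWindowFlowWindowLipschitzStubCommutatorBound

/-!
# Toolkit for stub `stub_relCommutatorBound` (E♭) of line `collar-cut-edge-mass`, crux `WeilWindowFlow.DiniLeakage`
(item stmt-RiemannHypothesis-1038)

`stub_relCommutatorBound_core`: the RELATIVE (`κ`-homogeneous) commutator bound for a NORMALISED
ground state — `u` measurable, pointwise zero off `[-a, a]`, pointwise bounded by `K_A`, obeying
the `L²` edge-mass law `∫_{a−r<|x|} |u|² ≤ κ r / log(1/r)` (`0 < r ≤ d₀ ≤ 1/4`, `0 < κ`) — and an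
admissible cutoff `χ` of width `h` (`16 h ≤ d₀`, `4 κ h ≤ 1`, dyadic index `2^J ≤ d₀/(4h) < 2^{J+1}`):

  `(arch) + (primes) + (poles) ≤ 128 κ h + κ h (96/log(1/(6h)) + 16/√J + 32 M²/J)`
  `   + √κ h/√J · (8 ρ(d₀/8)(A + 1/2) + 8 S_A K_A + 16 M² (A + 1/2))`,  `M = cosh(A/2)`,

and `∫ |χ u|² ≥ 1/2`.  This is the landed absolute core `…WindowLipschitz.stub_commutatorBound_core`
(item 1039) with the edge-mass constant tracked: the SCALE-COVARIANT toolkit lemmas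
`stub_commutatorBound_layer_le` / `stub_commutatorBound_arch_concrete` are applied to the rescaled
state `u/√κ` (edge-mass constant `1`, `stub_relCommutatorBound_rescale`), so every live pair carries
the factor `√κ` of its edge-zone point (`stub_relCommutatorBound_layer`, `stub_relCommutatorBound_arch`);
primes and poles are bounded through the same layer mass `∫_{a−2h<|x|} |u| ≤ 4 √κ h/√J`.

Sources: line card `Cruxes/DiniLeakage/Lines/collar-cut-edge-mass.md` §Stub E♭; Cycon–Froese–Kirsch–Simon,
*Schrödinger Operators*, Thm. 3.2 (IMS localisation formula).
-/

set_option linter.dupNamespace false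

noncomputable section

open MeasureTheory Set Filter
open scoped Topology ENNReal NNReal

namespace Summit.RiemannHypothesis.RiemannHypothesis.Theorems.WeilWindowFlowDiniLeakage

open Literature.NumberTheory.LFunctions
open Summit.RiemannHypothesis.RiemannHypothesis.Theorems.WeilWindowFlowWindowLipschitz

/-! ## Rescaling to edge-mass constant `1` -/

/-- **Rescaling.** If `u` (measurable, integrable, square integrable, zero off `[-a, a]`) obeys
the edge-mass law with constant `κ > 0` on `(0, d₀]`, then `us = u/√κ` is measurable, integrable,
square integrable, zero off `[-a, a]`, satisfies `√κ |us| = |u|`, and obeys the edge-mass law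
with constant `1`. -/
theorem stub_relCommutatorBound_rescale {u us : ℝ → ℂ} {a d₀ κ : ℝ} (hum : Measurable u)
    (hui : Integrable u) (hu2 : Integrable fun x ↦ ‖u x‖ ^ 2) (hκ : 0 < κ)
    (hB : ∀ r, 0 < r → r ≤ d₀ → ∫ x in {x | a - r < |x|}, ‖u x‖ ^ 2 ≤ κ * r / Real.log (1 / r))
    (hu0 : ∀ x, x ∉ Icc (-a) a → u x = 0)
    (hus : ∀ x, us x = (((Real.sqrt κ)⁻¹ : ℝ) : ℂ) * u x) :
    Measurable us ∧ Integrable us ∧ Integrable (fun x ↦ ‖us x‖ ^ 2) ∧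
      (∀ x, Real.sqrt κ * ‖us x‖ = ‖u x‖) ∧
      (∀ r, 0 < r → r ≤ d₀ →
        ∫ x in {x | a - r < |x|}, ‖us x‖ ^ 2 ≤ 1 * r / Real.log (1 / r)) ∧
      (∀ x, x ∉ Icc (-a) a → us x = 0) := by
  set R := Real.sqrt κ with hRdef
  have hR : 0 < R := Real.sqrt_pos.2 hκ
  have hR2 : R * R = κ := Real.mul_self_sqrt hκ.le
  have hfun : us = fun x ↦ ((R⁻¹ : ℝ) : ℂ) * u x := funext hus
  have hnus : ∀ x, ‖us x‖ = R⁻¹ * ‖u x‖ := fun x ↦ by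
    rw [hus, norm_mul, Complex.norm_real, Real.norm_eq_abs, abs_of_pos (inv_pos.2 hR)]
  have hnus2 : ∀ x, ‖us x‖ ^ 2 = κ⁻¹ * ‖u x‖ ^ 2 := fun x ↦ by
    rw [hnus, mul_pow, inv_pow, sq R, hR2]
  refine ⟨by rw [hfun]; exact measurable_const.mul hum, by rw [hfun]; exact hui.const_mul _,
    ?_, fun x ↦ ?_, fun r hr hrd ↦ ?_, fun x hx ↦ ?_⟩
  · simp_rw [hnus2]; exact hu2.const_mul _
  · rw [hnus, ← mul_assoc, mul_inv_cancel₀ hR.ne', one_mul]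
  · simp_rw [hnus2]
    rw [integral_const_mul]
    calc κ⁻¹ * ∫ x in {x | a - r < |x|}, ‖u x‖ ^ 2 ≤ κ⁻¹ * (κ * r / Real.log (1 / r)) :=
          mul_le_mul_of_nonneg_left (hB r hr hrd) (inv_pos.2 hκ).le
      _ = 1 * r / Real.log (1 / r) := by
          rw [← mul_div_assoc, ← mul_assoc, inv_mul_cancel₀ hκ.ne']
  · rw [hus, hu0 x hx, mul_zero]

/-! ## The dyadic index -/

/-- **The dyadic index.** If `16 h ≤ d₀ ≤ 1/4` and `2^J ≤ d₀/(4h) < 2^{J+1}`, then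
`2^{J+2} h ≤ d₀ < 2^{J+3} h`, `J ≥ 1` and `2^J ≤ 1/(2h)`. -/
theorem stub_relCommutatorBound_dyadic :
    ∀ {d₀ h : ℝ} {J : ℕ}, 0 < h → 16 * h ≤ d₀ → d₀ ≤ 1 / 4 → (2 : ℝ) ^ J ≤ d₀ / (4 * h) →
      d₀ / (4 * h) < 2 ^ (J + 1) →
      2 ^ (J + 2) * h ≤ d₀ ∧ d₀ < 2 ^ (J + 3) * h ∧ 1 ≤ J ∧ (2 : ℝ) ^ J ≤ 1 / (2 * h) := by
  intro d₀ h J hh hhd hd₁ hJ1 hJ2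
  refine ⟨?_, ?_, ?_, ?_⟩
  · have := (le_div_iff₀ (by positivity : (0 : ℝ) < 4 * h)).1 hJ1
    calc (2 : ℝ) ^ (J + 2) * h = 2 ^ J * (4 * h) := by ring
      _ ≤ d₀ := this
  · have := (div_lt_iff₀ (by positivity : (0 : ℝ) < 4 * h)).1 hJ2
    calc d₀ < 2 ^ (J + 1) * (4 * h) := this
      _ = 2 ^ (J + 3) * h := by ring
  · by_contra hJ0
    rw [not_le, Nat.lt_one_iff] at hJ0; subst hJ0
    have : (4 : ℝ) ≤ d₀ / (4 * h) := by rw [le_div_iff₀ (by positivity)]; linarith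
    norm_num at hJ2
    linarith
  · calc (2 : ℝ) ^ J ≤ d₀ / (4 * h) := hJ1
      _ ≤ 1 / (2 * h) := by
          rw [div_le_div_iff₀ (by positivity) (by positivity)]
          have : d₀ * (2 * h) ≤ 2 * (2 * h) :=
            mul_le_mul_of_nonneg_right (by linarith) (by positivity)
          linarith

/-! ## The layer mass -/

/-- **The relative layer mass.** Under the edge-mass law with constant `κ > 0`
(`0 < r ≤ d₀`, `d₀ ≤ 1/4` implicit in `2h ≤ d₀`, `2^J ≤ 1/(2h)`, `J ≥ 1`):
`∫_{a − 2h < |x|} |u| ≤ 4 √κ h / √J` (`stub_commutatorBound_layer_le` for `u/√κ`). -/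
theorem stub_relCommutatorBound_layer {u : ℝ → ℂ} {a d₀ κ h : ℝ} {J : ℕ} (hum : Measurable u)
    (hui : Integrable u) (hu2 : Integrable fun x ↦ ‖u x‖ ^ 2) (hκ : 0 < κ)
    (hB : ∀ r, 0 < r → r ≤ d₀ → ∫ x in {x | a - r < |x|}, ‖u x‖ ^ 2 ≤ κ * r / Real.log (1 / r))
    (hu0 : ∀ x, x ∉ Icc (-a) a → u x = 0) (hh : 0 < h) (h2d : 2 * h ≤ d₀) (hJge : 1 ≤ J)
    (hJpow : (2 : ℝ) ^ J ≤ 1 / (2 * h)) :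
    ∫ x in {x | a - 2 * h < |x|}, ‖u x‖ ≤ 4 * Real.sqrt κ * h / Real.sqrt J := by
  set us : ℝ → ℂ := fun x ↦ (((Real.sqrt κ)⁻¹ : ℝ) : ℂ) * u x with husdef
  obtain ⟨-, -, hus2, hRus, hBus, hus0⟩ :=
    stub_relCommutatorBound_rescale (us := us) hum hui hu2 hκ hB hu0 (fun x ↦ congrFun husdef x)
  have h1 := stub_commutatorBound_layer_le hus2 zero_le_one hBus hus0 hh h2d hJge hJpow
  have heq : ∫ x in {x | a - 2 * h < |x|}, ‖u x‖ =
      Real.sqrt κ * ∫ x in {x | a - 2 * h < |x|}, ‖us x‖ := by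
    rw [← integral_const_mul]
    exact integral_congr_ae (Eventually.of_forall fun x ↦ (hRus x).symm)
  rw [heq]
  exact (mul_le_mul_of_nonneg_left h1 (Real.sqrt_nonneg _)).trans_eq (by ring)

/-! ## The archimedean commutator term -/

/-- **The relative archimedean commutator term.** For a measurable window function `u` obeying
the edge-mass law with constant `κ > 0`, `‖u‖₁ ≤ A + 1/2`, and an admissible cutoff `χ` of width
`h` (`16h ≤ d₀`, dyadic index `J`):
`arch(u) ≤ 96 κ h/log(1/(6h)) + 16 κ h/√J + 128 κ h + 8 ρ(d₀/8)(A + 1/2) √κ h/√J`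
(`arch(u) = κ · arch(u/√κ)` and `stub_commutatorBound_arch_concrete` for `u/√κ`). -/
theorem stub_relCommutatorBound_arch {u : ℝ → ℂ} {χ : ℝ → ℝ} {a A d₀ κ h : ℝ} {J : ℕ}
    (hum : Measurable u) (hui : Integrable u) (hu2 : Integrable fun x ↦ ‖u x‖ ^ 2) (hκ : 0 < κ)
    (hd₀ : 0 < d₀) (hd₁ : d₀ ≤ 1 / 4)
    (hB : ∀ r, 0 < r → r ≤ d₀ → ∫ x in {x | a - r < |x|}, ‖u x‖ ^ 2 ≤ κ * r / Real.log (1 / r))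
    (hu0 : ∀ x, x ∉ Icc (-a) a → u x = 0) (hL1 : ∫ x, ‖u x‖ ≤ A + 1 / 2) (hh : 0 < h)
    (hhd : 16 * h ≤ d₀) (hJge : 1 ≤ J) (hJa : 2 ^ (J + 2) * h ≤ d₀) (hJb : d₀ < 2 ^ (J + 3) * h)
    (hJpow : (2 : ℝ) ^ J ≤ 1 / (2 * h))
    (hχlip : ∀ x y, |χ x - χ y| ≤ |x - y| / h) (hχ01 : ∀ x, 0 ≤ χ x ∧ χ x ≤ 1)
    (hχ1 : ∀ x, |x| ≤ a - 2 * h → χ x = 1) :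
    ∫ t in Ioi (0 : ℝ), weilArchDensity t *
        ∫ x, (χ (x + t) - χ x) ^ 2 * (‖u (x + t)‖ * ‖u x‖) ≤
      96 * κ * h / Real.log (1 / (6 * h)) + 16 * κ * h / Real.sqrt J + 128 * κ * h +
        8 * weilArchDensity (d₀ / 8) * (A + 1 / 2) * Real.sqrt κ * h / Real.sqrt J := by
  set us : ℝ → ℂ := fun x ↦ (((Real.sqrt κ)⁻¹ : ℝ) : ℂ) * u x with husdef
  obtain ⟨husm, husi, hus2, hRus, hBus, hus0⟩ :=
    stub_relCommutatorBound_rescale (us := us) hum hui hu2 hκ hB hu0 (fun x ↦ congrFun husdef x)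
  set R := Real.sqrt κ with hRdef
  have hR : 0 < R := Real.sqrt_pos.2 hκ
  have hR2 : R * R = κ := Real.mul_self_sqrt hκ.le
  have hsqrtJ : 1 ≤ Real.sqrt J := Real.one_le_sqrt.2 (by exact_mod_cast hJge)
  have hsqrtJpos : 0 < Real.sqrt J := by linarith
  -- layer mass and `L¹` norm of `us`
  have hBfus : ∫ x in {x | a - 2 * h < |x|}, ‖us x‖ ≤ 4 * h / Real.sqrt J := by
    have := stub_commutatorBound_layer_le hus2 zero_le_one hBus hus0 hh (by linarith) hJge hJpow
    convert this using 1; ring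
  have hBfus0 : 0 ≤ ∫ x in {x | a - 2 * h < |x|}, ‖us x‖ := integral_nonneg fun x ↦ norm_nonneg _
  have hUus : ∫ x, ‖u x‖ = R * ∫ x, ‖us x‖ := by
    rw [← integral_const_mul]
    exact integral_congr_ae (Eventually.of_forall fun x ↦ (hRus x).symm)
  have hκIus : κ * ∫ x, ‖us x‖ ≤ R * (A + 1 / 2) := by
    rw [← hR2, mul_assoc, ← hUus]; exact mul_le_mul_of_nonneg_left hL1 hR.le
  -- `arch(u) = κ · arch(us)`
  have hpt : ∀ t x, (χ (x + t) - χ x) ^ 2 * (‖u (x + t)‖ * ‖u x‖) =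
      κ * ((χ (x + t) - χ x) ^ 2 * (‖us (x + t)‖ * ‖us x‖)) := fun t x ↦ by
    rw [← hRus (x + t), ← hRus x, ← hR2]; ring
  have hinner : ∀ t, (∫ x, (χ (x + t) - χ x) ^ 2 * (‖u (x + t)‖ * ‖u x‖)) =
      κ * ∫ x, (χ (x + t) - χ x) ^ 2 * (‖us (x + t)‖ * ‖us x‖) := fun t ↦ by
    rw [← integral_const_mul]
    exact integral_congr_ae (Eventually.of_forall (hpt t))
  have hpt' : ∀ t, weilArchDensity t * (∫ x, (χ (x + t) - χ x) ^ 2 * (‖u (x + t)‖ * ‖u x‖)) =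
      κ * (weilArchDensity t * ∫ x, (χ (x + t) - χ x) ^ 2 * (‖us (x + t)‖ * ‖us x‖)) :=
    fun t ↦ by rw [hinner t]; ring
  have harch_eq : (∫ t in Ioi (0 : ℝ), weilArchDensity t *
        ∫ x, (χ (x + t) - χ x) ^ 2 * (‖u (x + t)‖ * ‖u x‖)) =
      κ * ∫ t in Ioi (0 : ℝ), weilArchDensity t *
        ∫ x, (χ (x + t) - χ x) ^ 2 * (‖us (x + t)‖ * ‖us x‖) := by
    rw [← integral_const_mul]
    exact integral_congr_ae (Eventually.of_forall hpt')
  have harchus := stub_commutatorBound_arch_concrete husm husi hus2 zero_le_one hd₀ hd₁ hBus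
    hus0 hh J hJa hJb hχlip hχ01 hχ1
  -- bookkeeping
  have hρ8 : 0 < weilArchDensity (d₀ / 8) := weilArchDensity_pos (by positivity)
  have hm6 : ∫ x in {x | a - 6 * h < |x|}, ‖us x‖ ^ 2 ≤ 1 * (6 * h) / Real.log (1 / (6 * h)) :=
    hBus _ (by positivity) (by linarith)
  set X := (1 + 1) + weilArchDensity (d₀ / 8) * ∫ x, ‖us x‖ with hX
  have hX0 : 0 ≤ X := by positivity
  have hsplit : (1 + 1) + 8 * (1 + 1) * Real.sqrt J + weilArchDensity (d₀ / 8) * ∫ x, ‖us x‖ =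
      X + 16 * Real.sqrt J := by
    rw [hX]; ring
  have hprod : ((1 + 1) + 8 * (1 + 1) * Real.sqrt J + weilArchDensity (d₀ / 8) * ∫ x, ‖us x‖) *
      ∫ x in {x | a - 2 * h < |x|}, ‖us x‖ ≤ X * (4 * h / Real.sqrt J) + 64 * h := by
    rw [hsplit, add_mul]
    refine add_le_add (mul_le_mul_of_nonneg_left hBfus hX0) ?_
    calc 16 * Real.sqrt J * ∫ x in {x | a - 2 * h < |x|}, ‖us x‖
        ≤ 16 * Real.sqrt J * (4 * h / Real.sqrt J) := mul_le_mul_of_nonneg_left hBfus (by positivity)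
      _ = 64 * h * (Real.sqrt J / Real.sqrt J) := by ring
      _ = 64 * h := by rw [div_self hsqrtJpos.ne', mul_one]
  have hκX : κ * X ≤ 2 * κ + weilArchDensity (d₀ / 8) * (R * (A + 1 / 2)) := by
    have : κ * X = 2 * κ + weilArchDensity (d₀ / 8) * (κ * ∫ x, ‖us x‖) := by
      rw [hX]; ring
    rw [this]
    exact add_le_add le_rfl (mul_le_mul_of_nonneg_left hκIus hρ8.le)
  have hhJ0 : 0 ≤ 4 * h / Real.sqrt J := by positivity
  calc _ = _ := harch_eq
    _ ≤ κ * (16 * (1 * (6 * h) / Real.log (1 / (6 * h))) +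
          2 * (X * (4 * h / Real.sqrt J) + 64 * h)) := by
        refine mul_le_mul_of_nonneg_left (harchus.trans ?_) hκ.le
        have h2 := mul_le_mul_of_nonneg_left hprod zero_le_two
        have h3 : 16 * (∫ x in {x | a - 6 * h < |x|}, ‖us x‖ ^ 2) ≤
            16 * (1 * (6 * h) / Real.log (1 / (6 * h))) :=
          mul_le_mul_of_nonneg_left hm6 (by norm_num)
        linarith only [h2, h3]
    _ = 16 * κ * (1 * (6 * h) / Real.log (1 / (6 * h))) +
          2 * (κ * X) * (4 * h / Real.sqrt J) + 128 * κ * h := by ring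
    _ ≤ 16 * κ * (1 * (6 * h) / Real.log (1 / (6 * h))) +
          2 * (2 * κ + weilArchDensity (d₀ / 8) * (R * (A + 1 / 2))) * (4 * h / Real.sqrt J) +
          128 * κ * h := by
        have := mul_le_mul_of_nonneg_right (mul_le_mul_of_nonneg_left hκX zero_le_two) hhJ0
        linarith only [this]
    _ = _ := by ring

/-! ## The core bound -/

/-- **The relative commutator bound for a normalised ground state.** See the module docstring. -/
theorem stub_relCommutatorBound_core {u : ℝ → ℂ} {χ : ℝ → ℝ} {a A d₀ KA κ h SA : ℝ} {J : ℕ}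
    (hum : Measurable u) (hu : IsWeilGroundState a u)
    (hu0 : ∀ x, x ∉ Icc (-a) a → u x = 0) (hbd : ∀ x, ‖u x‖ ≤ KA) (hκ : 0 < κ)
    (hd₀ : 0 < d₀) (hd₁ : d₀ ≤ 1 / 4)
    (hB : ∀ r, 0 < r → r ≤ d₀ → ∫ x in {x | a - r < |x|}, ‖u x‖ ^ 2 ≤ κ * r / Real.log (1 / r))
    (haA : a ≤ A)
    (hSA : ∑ n ∈ weilPrimeIndex a, (ArithmeticFunction.vonMangoldt n : ℝ) / Real.sqrt n ≤ SA)
    (hh : 0 < h) (hhd : 16 * h ≤ d₀) (hhκ : 4 * κ * h ≤ 1)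
    (hJ1 : (2 : ℝ) ^ J ≤ d₀ / (4 * h)) (hJ2 : d₀ / (4 * h) < 2 ^ (J + 1))
    (hχlip : ∀ x y, |χ x - χ y| ≤ |x - y| / h) (hχ01 : ∀ x, 0 ≤ χ x ∧ χ x ≤ 1)
    (hχ1 : ∀ x, |x| ≤ a - 2 * h → χ x = 1) :
    (∫ t in Ioi (0 : ℝ), weilArchDensity t *
          ∫ x, (χ (x + t) - χ x) ^ 2 * (‖u (x + t)‖ * ‖u x‖)) +
      (∑ n ∈ weilPrimeIndex a, (ArithmeticFunction.vonMangoldt n : ℝ) / Real.sqrt n *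
          ∫ x, (χ (x + Real.log n) - χ x) ^ 2 * (‖u (x + Real.log n)‖ * ‖u x‖)) +
      2 * ‖∫ t, ((1 - χ t : ℝ) : ℂ) * u t * (Real.cosh (t / 2) : ℂ)‖ ^ 2 +
      2 * ‖∫ t, u t * (Real.cosh (t / 2) : ℂ)‖ *
          ‖∫ t, (((1 - χ t) ^ 2 : ℝ) : ℂ) * u t * (Real.cosh (t / 2) : ℂ)‖ +
      2 * ‖∫ t, u t * (Real.sinh (t / 2) : ℂ)‖ *
          ‖∫ t, (((1 - χ t) ^ 2 : ℝ) : ℂ) * u t * (Real.sinh (t / 2) : ℂ)‖ ≤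
      128 * κ * h +
        κ * h * (96 / Real.log (1 / (6 * h)) + 16 / Real.sqrt J +
          32 * Real.cosh (A / 2) ^ 2 / J) +
        Real.sqrt κ * h / Real.sqrt J * (8 * weilArchDensity (d₀ / 8) * (A + 1 / 2) +
          8 * SA * KA + 16 * Real.cosh (A / 2) ^ 2 * (A + 1 / 2)) ∧
    1 / 2 ≤ ∫ x, ‖(χ x : ℂ) * u x‖ ^ 2 := by
  have ha : 0 < a := hu.pos
  have hA : 0 < A := ha.trans_le haA
  have hKA : 0 ≤ KA := (norm_nonneg _).trans (hbd 0)
  have hui : Integrable u := hu.integrable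
  have hu2 : Integrable fun x ↦ ‖u x‖ ^ 2 :=
    (memLp_two_iff_integrable_sq_norm hu.memLp.1).1 hu.memLp
  have hnorm : ∫ x, ‖u x‖ ^ 2 = 1 := hu.integral_norm_sq
  have hh1 : h ≤ 1 := by linarith
  -- simplified edge-mass law `∫_{a-r<|x|} |u|² ≤ κ r`
  have hB1 : ∀ r, 0 < r → r ≤ d₀ → ∫ x in {x | a - r < |x|}, ‖u x‖ ^ 2 ≤ κ * r := by
    intro r hr hrd
    have hq : Real.exp 1 ≤ 1 / r := by
      rw [le_div_iff₀ hr]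
      calc Real.exp 1 * r ≤ 2.7182818286 * (1 / 4) :=
            mul_le_mul Real.exp_one_lt_d9.le (hrd.trans hd₁) hr.le (by norm_num)
        _ ≤ 1 := by norm_num
    have hl : 1 ≤ Real.log (1 / r) := by simpa using Real.log_le_log (Real.exp_pos 1) hq
    calc _ ≤ κ * r / Real.log (1 / r) := hB r hr hrd
      _ ≤ κ * r / 1 := div_le_div_of_nonneg_left (by positivity) one_pos hl
      _ = κ * r := div_one _
  -- the dyadic index
  obtain ⟨hJa, hJb, hJge, hJpow⟩ := stub_relCommutatorBound_dyadic hh hhd hd₁ hJ1 hJ2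
  have hJpos : (0 : ℝ) < J := by exact_mod_cast hJge
  -- `‖u‖₁ ≤ A + 1/2`
  have hL1 : ∫ x, ‖u x‖ ≤ A + 1 / 2 := by
    have := stub_commutatorBound_norm_one_le ha.le hu0 hu2
    rw [hnorm] at this
    linarith
  -- (1) the archimedean term
  have hT1 := stub_relCommutatorBound_arch hum hui hu2 hκ hd₀ hd₁ hB hu0 hL1 hh hhd hJge hJa hJb
    hJpow hχlip hχ01 hχ1
  -- the layer mass `Bf ≤ 4 √κ h / √J`
  set L2 := {x : ℝ | a - 2 * h < |x|} with hL2
  have hL2m : MeasurableSet L2 := stub_commutatorBound_measurableSet_layer a _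
  set Bf := ∫ x in L2, ‖u x‖ with hBf
  have hBfle : Bf ≤ 4 * Real.sqrt κ * h / Real.sqrt J :=
    stub_relCommutatorBound_layer hum hui hu2 hκ hB hu0 hh (by linarith) hJge hJpow
  set R := Real.sqrt κ with hRdef
  have hR : 0 < R := Real.sqrt_pos.2 hκ
  have hR2 : R * R = κ := Real.mul_self_sqrt hκ.le
  have hf0 : ∀ x, 0 ≤ L2.indicator (fun x ↦ ‖u x‖) x :=
    fun x ↦ indicator_nonneg (fun _ _ ↦ norm_nonneg _) x
  have hfb : ∀ y, a - |y| < 2 * h → ‖u y‖ ≤ L2.indicator (fun x ↦ ‖u x‖) y := fun y hy ↦ by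
    rw [indicator_of_mem (show y ∈ L2 by show a - 2 * h < |y|; linarith)]
  have hfi : Integrable (L2.indicator fun x ↦ ‖u x‖) := hui.norm.indicator hL2m
  have hintf : ∫ x, L2.indicator (fun x ↦ ‖u x‖) x = Bf := integral_indicator hL2m
  -- (2) the prime terms
  have hT2 : ∑ n ∈ weilPrimeIndex a, (ArithmeticFunction.vonMangoldt n : ℝ) / Real.sqrt n *
        ∫ x, (χ (x + Real.log n) - χ x) ^ 2 * (‖u (x + Real.log n)‖ * ‖u x‖) ≤
      SA * (8 * KA * R * h / Real.sqrt J) := by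
    have hterm : ∀ n ∈ weilPrimeIndex a,
        (ArithmeticFunction.vonMangoldt n : ℝ) / Real.sqrt n *
          ∫ x, (χ (x + Real.log n) - χ x) ^ 2 * (‖u (x + Real.log n)‖ * ‖u x‖) ≤
        (ArithmeticFunction.vonMangoldt n : ℝ) / Real.sqrt n * (8 * KA * R * h / Real.sqrt J) := by
      intro n _
      refine mul_le_mul_of_nonneg_left ?_
        (div_nonneg ArithmeticFunction.vonMangoldt_nonneg (Real.sqrt_nonneg _))
      calc _ ≤ 2 * KA * ∫ x, L2.indicator (fun x ↦ ‖u x‖) x :=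
            stub_commutatorBound_prime_le hχ01 hχ1 hbd hf0 hfb hfi (Real.log n)
        _ = 2 * KA * Bf := by rw [hintf]
        _ ≤ 2 * KA * (4 * R * h / Real.sqrt J) := mul_le_mul_of_nonneg_left hBfle (by positivity)
        _ = 8 * KA * R * h / Real.sqrt J := by ring
    calc _ ≤ ∑ n ∈ weilPrimeIndex a, (ArithmeticFunction.vonMangoldt n : ℝ) / Real.sqrt n *
          (8 * KA * R * h / Real.sqrt J) := Finset.sum_le_sum hterm
      _ = (∑ n ∈ weilPrimeIndex a, (ArithmeticFunction.vonMangoldt n : ℝ) / Real.sqrt n) *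
          (8 * KA * R * h / Real.sqrt J) := (Finset.sum_mul _ _ _).symm
      _ ≤ SA * (8 * KA * R * h / Real.sqrt J) := mul_le_mul_of_nonneg_right hSA (by positivity)
  -- (3) the pole terms
  set M := Real.cosh (A / 2) with hMdef
  have hM : 0 ≤ M := (Real.cosh_pos _).le
  have hwc : ∀ x, |x| ≤ a → |Real.cosh (x / 2)| ≤ M :=
    fun x hx ↦ (stub_commutatorBound_cosh_sinh_le haA hx).1
  have hws : ∀ x, |x| ≤ a → |Real.sinh (x / 2)| ≤ M :=
    fun x hx ↦ (stub_commutatorBound_cosh_sinh_le haA hx).2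
  have hθ1 : ∀ x, |1 - χ x| ≤ 1 :=
    fun x ↦ abs_le.2 ⟨by linarith [(hχ01 x).2], by linarith [(hχ01 x).1]⟩
  have hθ2 : ∀ x, |(1 - χ x) ^ 2| ≤ 1 := fun x ↦ by
    rw [abs_pow]
    exact (pow_le_pow_left₀ (abs_nonneg _) (hθ1 x) 2).trans_eq (one_pow 2)
  have hθ10 : ∀ x, |x| ≤ a - 2 * h → 1 - χ x = 0 := fun x hx ↦ by rw [hχ1 x hx, sub_self]
  have hθ20 : ∀ x, |x| ≤ a - 2 * h → (1 - χ x) ^ 2 = 0 := fun x hx ↦ by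
    rw [hθ10 x hx]; norm_num
  have hP1 : ‖∫ t, ((1 - χ t : ℝ) : ℂ) * u t * (Real.cosh (t / 2) : ℂ)‖ ≤ M * Bf := by
    have := stub_commutatorBound_pole_le (θ := fun t ↦ 1 - χ t) (w := fun t ↦ Real.cosh (t / 2))
      hu0 hθ1 hθ10 hf0 hfb hfi hM hwc
    rwa [hintf] at this
  have hP2 : ‖∫ t, (((1 - χ t) ^ 2 : ℝ) : ℂ) * u t * (Real.cosh (t / 2) : ℂ)‖ ≤ M * Bf := by
    have := stub_commutatorBound_pole_le (θ := fun t ↦ (1 - χ t) ^ 2)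
      (w := fun t ↦ Real.cosh (t / 2)) hu0 hθ2 hθ20 hf0 hfb hfi hM hwc
    rwa [hintf] at this
  have hP3 : ‖∫ t, (((1 - χ t) ^ 2 : ℝ) : ℂ) * u t * (Real.sinh (t / 2) : ℂ)‖ ≤ M * Bf := by
    have := stub_commutatorBound_pole_le (θ := fun t ↦ (1 - χ t) ^ 2)
      (w := fun t ↦ Real.sinh (t / 2)) hu0 hθ2 hθ20 hf0 hfb hfi hM hws
    rwa [hintf] at this
  have hQ1 : ‖∫ t, u t * (Real.cosh (t / 2) : ℂ)‖ ≤ M * (A + 1 / 2) :=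
    (stub_commutatorBound_pairing_le (w := fun t ↦ Real.cosh (t / 2)) hu0 hui hwc).trans
      (mul_le_mul_of_nonneg_left hL1 hM)
  have hQ2 : ‖∫ t, u t * (Real.sinh (t / 2) : ℂ)‖ ≤ M * (A + 1 / 2) :=
    (stub_commutatorBound_pairing_le (w := fun t ↦ Real.sinh (t / 2)) hu0 hui hws).trans
      (mul_le_mul_of_nonneg_left hL1 hM)
  have hPle : M * Bf ≤ 4 * M * R * h / Real.sqrt J :=
    (mul_le_mul_of_nonneg_left hBfle hM).trans_eq (by ring)
  have hP0 : 0 ≤ 4 * M * R * h / Real.sqrt J := by positivity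
  have hT3 : 2 * ‖∫ t, ((1 - χ t : ℝ) : ℂ) * u t * (Real.cosh (t / 2) : ℂ)‖ ^ 2 ≤
      32 * M ^ 2 * κ * h / J := by
    have h1 : ‖∫ t, ((1 - χ t : ℝ) : ℂ) * u t * (Real.cosh (t / 2) : ℂ)‖ ≤
        4 * M * R * h / Real.sqrt J := hP1.trans hPle
    have h2 : ‖∫ t, ((1 - χ t : ℝ) : ℂ) * u t * (Real.cosh (t / 2) : ℂ)‖ ^ 2 ≤
        (4 * M * R * h / Real.sqrt J) ^ 2 := pow_le_pow_left₀ (norm_nonneg _) h1 2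
    have h3 : (4 * M * R * h / Real.sqrt J) ^ 2 = 16 * M ^ 2 * κ * h ^ 2 / J := by
      rw [div_pow, Real.sq_sqrt hJpos.le, ← hR2]; ring
    have h4 : h ^ 2 ≤ h := by
      rw [sq]; exact (mul_le_mul_of_nonneg_right hh1 hh.le).trans_eq (one_mul h)
    have h5 : 16 * M ^ 2 * κ * h ^ 2 / J ≤ 16 * M ^ 2 * κ * h / J :=
      div_le_div_of_nonneg_right (mul_le_mul_of_nonneg_left h4 (by positivity)) hJpos.le
    rw [h3] at h2
    calc _ ≤ 2 * (16 * M ^ 2 * κ * h ^ 2 / J) := mul_le_mul_of_nonneg_left h2 zero_le_two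
      _ ≤ 2 * (16 * M ^ 2 * κ * h / J) := mul_le_mul_of_nonneg_left h5 zero_le_two
      _ = 32 * M ^ 2 * κ * h / J := by ring
  have hQ0 : 0 ≤ 2 * (M * (A + 1 / 2)) := by positivity
  have hT4 : 2 * ‖∫ t, u t * (Real.cosh (t / 2) : ℂ)‖ *
        ‖∫ t, (((1 - χ t) ^ 2 : ℝ) : ℂ) * u t * (Real.cosh (t / 2) : ℂ)‖ ≤
      2 * (M * (A + 1 / 2)) * (4 * M * R * h / Real.sqrt J) :=
    mul_le_mul (mul_le_mul_of_nonneg_left hQ1 zero_le_two) (hP2.trans hPle) (norm_nonneg _) hQ0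
  have hT5 : 2 * ‖∫ t, u t * (Real.sinh (t / 2) : ℂ)‖ *
        ‖∫ t, (((1 - χ t) ^ 2 : ℝ) : ℂ) * u t * (Real.sinh (t / 2) : ℂ)‖ ≤
      2 * (M * (A + 1 / 2)) * (4 * M * R * h / Real.sqrt J) :=
    mul_le_mul (mul_le_mul_of_nonneg_left hQ2 zero_le_two) (hP3.trans hPle) (norm_nonneg _) hQ0
  refine ⟨?_, ?_⟩
  · -- assembly
    have hsum := add_le_add (add_le_add (add_le_add (add_le_add hT1 hT2) hT3) hT4) hT5
    refine hsum.trans (le_of_eq ?_)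
    ring
  · -- (4) the mass of the cut state
    have hχc : Continuous χ := by
      refine (LipschitzWith.of_dist_le_mul (K := Real.toNNReal (1 / h)) fun x y ↦ ?_).continuous
      rw [Real.dist_eq, Real.dist_eq, Real.coe_toNNReal _ (by positivity)]
      calc |χ x - χ y| ≤ |x - y| / h := hχlip x y
        _ = 1 / h * |x - y| := by ring
    have hmass := stub_commutatorBound_mass_ge hu.memLp.1 hu2 hχc hχ01 hχ1
    rw [hnorm] at hmass
    have hm2 : ∫ x in {x | a - 2 * h < |x|}, ‖u x‖ ^ 2 ≤ κ * (2 * h) :=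
      hB1 _ (by positivity) (by linarith)
    have : κ * (2 * h) ≤ 1 / 2 := by linarith
    linarith

end Summit.RiemannHypothesis.RiemannHypothesis.Theorems.WeilWindowFlowDiniLeakage

end
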